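import Summits.Ventures.PercRepro.C025ProfileOneFlatRowsTau

/-!
# TWO FAT FLATS: THE ROWS OF (Π) FROM THE ARITHMETIC CORE, SPLIT FORM (night-3 g26)

`proofs/NIGHT3-G26-TWOFLATS.md` §5.  For a finite matroid `M` with `gr M = E₁ ∪ E₂ ∪ E₃` (pairwise disjoint; `k₁ = #E₁`,
`k₂ = #E₂`, `m = #E₃`) and rank function `ρ(X) = min(r, min(|X∩E₁|, s₁) + min(|X∩E₂|, s₂) + |X∩E₃|)` — every truncation
`T_r(U_{s₁,E₁} ⊕ U_{s₂,E₂} ⊕ U_{m,m})` — the row `(q, u)` of (Π) with `q < u < r` follows from the arithmetic core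
  (TF)  Σ_{i₁ ≤ k₁, i₂ ≤ k₂} C(k₁,i₁)C(k₂,i₂)·[c₁+c₂ ≤ q ∧ u ≤ p(i₁,i₂)]·C(m, q−c₁−c₂)·C(p(i₁,i₂), u−q)
          ≤ C(u,q) · Σ_{j₁ ≤ k₁, j₂ ≤ k₂} C(k₁,j₁)C(k₂,j₂)·[c(j₁)+c(j₂) ≤ u]·C(m, u−c(j₁)−c(j₂)),
`c_l = min(i_l, s_l)`, `p(i₁,i₂) = min(k₁−i₁,s₁) + min(k₂−i₂,s₂) + (m − (q − c₁ − c₂))`, by g25's three steps: a member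
with `(i₁, i₂)` fat points has complement rank `min(r, p(i₁,i₂))` (`eRk_compl_eq_two`) and price at most
`C(p, u−q)/C(u,q)` (`price_le_type_two`); the members of type `(i₁,i₂)` number at most `C(k₁,i₁)C(k₂,i₂)C(m, q−c₁−c₂)`
(`card_Rq_two_le`); the level `u` contains the `C(k₁,j₁)C(k₂,j₂)C(m, u−c(j₁)−c(j₂))` unions (`card_levelSet_two_ge`).
(TF) is the hypothesis `hTF` of `profileIneq_rows_twoFlat_of_arith` — the two-flat `rows_arith`, the symbolic certificate
of the two-flat injection (paper §2–§3), NOT yet a theorem.  No `def`, no `instance`, no notation.  Axioms: standard.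
-/

open scoped Matroid

namespace PercRepro

open Finset ThmH

namespace TwoFlat

variable {α : Type} [DecidableEq α]

section Split

variable (M : Matroid α) [M.Finite] (E₁ E₂ E₃ : Finset α) (s₁ s₂ r : ℕ)

/-- The three parts of a subset of the ground set. -/
theorem eq_union_three (hE : gr M = E₁ ∪ E₂ ∪ E₃) {B : Finset α} (hB : B ⊆ gr M) :
    B = B ∩ E₁ ∪ B ∩ E₂ ∪ B ∩ E₃ := by
  rw [← inter_union_distrib_left, ← inter_union_distrib_left, ← hE]
  exact (inter_eq_left.2 hB).symm

/-- The complement's parts: `(gr M ∖ B) ∩ E_l = E_l ∖ B`. -/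
theorem compl_inter_eq (hE : gr M = E₁ ∪ E₂ ∪ E₃) (B : Finset α) :
    (gr M \ B) ∩ E₁ = E₁ \ B ∧ (gr M \ B) ∩ E₂ = E₂ \ B ∧ (gr M \ B) ∩ E₃ = E₃ \ B := by
  have h1 : E₁ ⊆ gr M := by rw [hE]; exact subset_union_left.trans subset_union_left
  have h2 : E₂ ⊆ gr M := by rw [hE]; exact subset_union_right.trans subset_union_left
  have h3 : E₃ ⊆ gr M := by rw [hE]; exact subset_union_right
  refine ⟨?_, ?_, ?_⟩ <;>
  · ext x
    simp only [mem_inter, mem_sdiff]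
    constructor
    · exact fun h => ⟨h.2, h.1.2⟩
    · intro h
      exact ⟨⟨by first | exact h1 h.1 | exact h2 h.1 | exact h3 h.1, h.2⟩, h.1⟩

/-- The rank of the complement of a rank-`q` set with `(i₁, i₂)` fat points:
`min(r, min(k₁−i₁,s₁) + min(k₂−i₂,s₂) + (m − (q − c₁ − c₂)))`. -/
theorem eRk_compl_eq_two (hE : gr M = E₁ ∪ E₂ ∪ E₃)
    (hrk : ∀ X : Finset α, X ⊆ gr M →
      M.eRk (X : Set α) =
        ((min r (min (X ∩ E₁).card s₁ + min (X ∩ E₂).card s₂ + (X ∩ E₃).card) : ℕ) : ℕ∞))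
    {q : ℕ} (hqr : q < r) {B : Finset α} (hB : B ∈ Profile.Rq M q) :
    M.eRk ((gr M \ B : Finset α) : Set α) =
      ((min r (min (E₁.card - (B ∩ E₁).card) s₁ + min (E₂.card - (B ∩ E₂).card) s₂ +
        (E₃.card - (q - min (B ∩ E₁).card s₁ - min (B ∩ E₂).card s₂))) : ℕ) : ℕ∞) := by
  rw [Profile.mem_Rq] at hB
  obtain ⟨hBg, hBq⟩ := hB
  rw [hrk B hBg] at hBq
  have hBq' : min r (min (B ∩ E₁).card s₁ + min (B ∩ E₂).card s₂ + (B ∩ E₃).card) = q := by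
    exact_mod_cast hBq
  have hmem : min (B ∩ E₁).card s₁ + min (B ∩ E₂).card s₂ + (B ∩ E₃).card = q := by omega
  obtain ⟨hc₁, hc₂, hc₃⟩ := compl_inter_eq M E₁ E₂ E₃ hE B
  rw [hrk (gr M \ B) sdiff_subset, hc₁, hc₂, hc₃, card_sdiff, card_sdiff, card_sdiff]
  congr 3
  omega

/-- The price of a rank-`q` set with `(i₁, i₂)` fat points at level `u` is at most the threshold-`u` price of the
untruncated complement rank `p = min(k₁−i₁,s₁) + min(k₂−i₂,s₂) + (m − (q − c₁ − c₂))`, as `C(p, u−q)/C(u,q)`. -/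
theorem price_le_type_two (hE : gr M = E₁ ∪ E₂ ∪ E₃)
    (hrk : ∀ X : Finset α, X ⊆ gr M →
      M.eRk (X : Set α) =
        ((min r (min (X ∩ E₁).card s₁ + min (X ∩ E₂).card s₂ + (X ∩ E₃).card) : ℕ) : ℕ∞))
    {q u : ℕ} (hqu : q ≤ u) (hqr : q < r) {B : Finset α} (hB : B ∈ Profile.Rq M q) :
    Profile.price M q u B ≤
      (if u ≤ min (E₁.card - (B ∩ E₁).card) s₁ + min (E₂.card - (B ∩ E₂).card) s₂ +
          (E₃.card - (q - min (B ∩ E₁).card s₁ - min (B ∩ E₂).card s₂)) then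
        ((min (E₁.card - (B ∩ E₁).card) s₁ + min (E₂.card - (B ∩ E₂).card) s₂ +
          (E₃.card - (q - min (B ∩ E₁).card s₁ - min (B ∩ E₂).card s₂))).choose (u - q) : ℚ) /
          (u.choose q : ℚ)
      else 0) := by
  have hp := eRk_compl_eq_two M E₁ E₂ E₃ s₁ s₂ r hE hrk hqr hB
  set p' := min (E₁.card - (B ∩ E₁).card) s₁ + min (E₂.card - (B ∩ E₂).card) s₂ +
    (E₃.card - (q - min (B ∩ E₁).card s₁ - min (B ∩ E₂).card s₂)) with hp'
  by_cases hup : u ≤ min r p'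
  · rw [PriceMono.price_eq_of_le hp hup, if_pos (by omega)]
    calc ((min r p' + q).choose u : ℚ) / ((min r p' + q).choose q : ℚ)
        ≤ ((p' + q).choose u : ℚ) / ((p' + q).choose q : ℚ) :=
          PriceMono.choose_div_choose_mono hqu hup (min_le_right _ _)
      _ = (p'.choose (u - q) : ℚ) / (u.choose q : ℚ) := OneFlat.choose_div_choose_eq_choose_div hqu
  · have : Profile.price M q u B = 0 := by
      unfold Profile.price
      rw [hp, if_neg (by exact_mod_cast hup)]
    rw [this]
    split_ifs <;> positivity

/-- The members of type `(i₁, i₂)` inject into (`i₁`-subsets of `E₁`) × (`i₂`-subsets of `E₂`) ×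
(`(q − c₁ − c₂)`-subsets of `E₃`); when `c₁ + c₂ > q` there are none. -/
theorem card_Rq_two_le (hE : gr M = E₁ ∪ E₂ ∪ E₃)
    (hrk : ∀ X : Finset α, X ⊆ gr M →
      M.eRk (X : Set α) =
        ((min r (min (X ∩ E₁).card s₁ + min (X ∩ E₂).card s₂ + (X ∩ E₃).card) : ℕ) : ℕ∞))
    (q : ℕ) (hqr : q < r) (i₁ i₂ : ℕ) :
    (((Profile.Rq M q).filter (fun B => ((B ∩ E₁).card, (B ∩ E₂).card) = (i₁, i₂))).card : ℚ) ≤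
      (E₁.card.choose i₁ : ℚ) * (E₂.card.choose i₂ : ℚ) *
        (if min i₁ s₁ + min i₂ s₂ ≤ q then ((E₃.card).choose (q - min i₁ s₁ - min i₂ s₂) : ℚ) else 0) := by
  by_cases hc : min i₁ s₁ + min i₂ s₂ ≤ q
  · rw [if_pos hc]
    have : ((Profile.Rq M q).filter (fun B => ((B ∩ E₁).card, (B ∩ E₂).card) = (i₁, i₂))).card ≤
        E₁.card.choose i₁ * E₂.card.choose i₂ * (E₃.card).choose (q - min i₁ s₁ - min i₂ s₂) := by
      rw [← card_powersetCard, ← card_powersetCard, ← card_powersetCard, ← card_product, ← card_product]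
      apply card_le_card_of_injOn (fun B => ((B ∩ E₁, B ∩ E₂), B ∩ E₃))
      · intro B hB
        simp only [coe_filter, Set.mem_setOf_eq, Profile.mem_Rq, Prod.mk.injEq] at hB
        obtain ⟨⟨hBg, hBq⟩, hBi₁, hBi₂⟩ := hB
        rw [hrk B hBg] at hBq
        have hBq' : min r (min (B ∩ E₁).card s₁ + min (B ∩ E₂).card s₂ + (B ∩ E₃).card) = q := by
          exact_mod_cast hBq
        simp only [coe_product, Set.mem_prod, mem_coe, mem_powersetCard]
        refine ⟨⟨⟨inter_subset_right, hBi₁⟩, inter_subset_right, hBi₂⟩, inter_subset_right, ?_⟩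
        rw [← hBi₁, ← hBi₂]; omega
      · intro B hB B' hB' hBB'
        simp only [coe_filter, Set.mem_setOf_eq, Profile.mem_Rq] at hB hB'
        simp only [Prod.mk.injEq] at hBB'
        rw [eq_union_three M E₁ E₂ E₃ hE hB.1.1, eq_union_three M E₁ E₂ E₃ hE hB'.1.1,
          hBB'.1.1, hBB'.1.2, hBB'.2]
    exact_mod_cast this
  · rw [if_neg hc, mul_zero]
    have : (Profile.Rq M q).filter (fun B => ((B ∩ E₁).card, (B ∩ E₂).card) = (i₁, i₂)) = ∅ := by
      rw [filter_eq_empty_iff]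
      intro B hB hBi
      rw [Profile.mem_Rq] at hB
      have hBq := hB.2
      rw [hrk B hB.1] at hBq
      have hBq' : min r (min (B ∩ E₁).card s₁ + min (B ∩ E₂).card s₂ + (B ∩ E₃).card) = q := by
        exact_mod_cast hBq
      simp only [Prod.mk.injEq] at hBi
      rw [hBi.1, hBi.2] at hBq'
      omega
    rw [this, card_empty]; simp

/-- (`j₁`-subsets of `E₁`) × (`j₂`-subsets of `E₂`) × (`(u − c(j₁) − c(j₂))`-subsets of `E₃`) inject by union into the
level `u < r`, fibre `(|S ∩ E₁|, |S ∩ E₂|) = (j₁, j₂)`, when `c(j₁) + c(j₂) ≤ u`. -/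
theorem card_levelSet_two_ge (hE : gr M = E₁ ∪ E₂ ∪ E₃) (h12 : Disjoint E₁ E₂) (h13 : Disjoint E₁ E₃)
    (h23 : Disjoint E₂ E₃)
    (hrk : ∀ X : Finset α, X ⊆ gr M →
      M.eRk (X : Set α) =
        ((min r (min (X ∩ E₁).card s₁ + min (X ∩ E₂).card s₂ + (X ∩ E₃).card) : ℕ) : ℕ∞))
    {u : ℕ} (hur : u < r) (j₁ j₂ : ℕ) (hju : min j₁ s₁ + min j₂ s₂ ≤ u) :
    E₁.card.choose j₁ * E₂.card.choose j₂ * (E₃.card).choose (u - min j₁ s₁ - min j₂ s₂) ≤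
      ((Shadow.levelSet M u).filter (fun S => ((S ∩ E₁).card, (S ∩ E₂).card) = (j₁, j₂))).card := by
  have e1 : ∀ (Y₁ Y₂ Z : Finset α), Y₁ ⊆ E₁ → Y₂ ⊆ E₂ → Z ⊆ E₃ → (Y₁ ∪ Y₂ ∪ Z) ∩ E₁ = Y₁ := by
    intro Y₁ Y₂ Z hY₁ hY₂ hZ
    rw [union_inter_distrib_right, union_inter_distrib_right, inter_eq_left.2 hY₁,
      disjoint_iff_inter_eq_empty.1 (disjoint_of_subset_left hY₂ h12.symm),
      disjoint_iff_inter_eq_empty.1 (disjoint_of_subset_left hZ h13.symm), union_empty, union_empty]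
  have e2 : ∀ (Y₁ Y₂ Z : Finset α), Y₁ ⊆ E₁ → Y₂ ⊆ E₂ → Z ⊆ E₃ → (Y₁ ∪ Y₂ ∪ Z) ∩ E₂ = Y₂ := by
    intro Y₁ Y₂ Z hY₁ hY₂ hZ
    rw [union_inter_distrib_right, union_inter_distrib_right, inter_eq_left.2 hY₂,
      disjoint_iff_inter_eq_empty.1 (disjoint_of_subset_left hY₁ h12),
      disjoint_iff_inter_eq_empty.1 (disjoint_of_subset_left hZ h23.symm), empty_union, union_empty]
  have e3 : ∀ (Y₁ Y₂ Z : Finset α), Y₁ ⊆ E₁ → Y₂ ⊆ E₂ → Z ⊆ E₃ → (Y₁ ∪ Y₂ ∪ Z) ∩ E₃ = Z := by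
    intro Y₁ Y₂ Z hY₁ hY₂ hZ
    rw [union_inter_distrib_right, union_inter_distrib_right, inter_eq_left.2 hZ,
      disjoint_iff_inter_eq_empty.1 (disjoint_of_subset_left hY₁ h13),
      disjoint_iff_inter_eq_empty.1 (disjoint_of_subset_left hY₂ h23), empty_union, empty_union]
  rw [← card_powersetCard, ← card_powersetCard, ← card_powersetCard, ← card_product, ← card_product]
  apply card_le_card_of_injOn (fun YZ : (Finset α × Finset α) × Finset α => YZ.1.1 ∪ YZ.1.2 ∪ YZ.2)
  · rintro ⟨⟨Y₁, Y₂⟩, Z⟩ hYZ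
    simp only [coe_product, Set.mem_prod, mem_coe, mem_powersetCard] at hYZ
    obtain ⟨⟨⟨hY₁, hY₁c⟩, hY₂, hY₂c⟩, hZ, hZc⟩ := hYZ
    have hsub : Y₁ ∪ Y₂ ∪ Z ⊆ gr M := by
      rw [hE]; exact union_subset_union (union_subset_union hY₁ hY₂) hZ
    simp only [coe_filter, Set.mem_setOf_eq, Profile.mem_levelSet, Prod.mk.injEq]
    refine ⟨⟨hsub, ?_⟩, by rw [e1 Y₁ Y₂ Z hY₁ hY₂ hZ]; exact hY₁c, by rw [e2 Y₁ Y₂ Z hY₁ hY₂ hZ]; exact hY₂c⟩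
    rw [hrk _ hsub, e1 Y₁ Y₂ Z hY₁ hY₂ hZ, e2 Y₁ Y₂ Z hY₁ hY₂ hZ, e3 Y₁ Y₂ Z hY₁ hY₂ hZ, hY₁c, hY₂c, hZc]
    congr 1
    omega
  · rintro ⟨⟨Y₁, Y₂⟩, Z⟩ hYZ ⟨⟨Y₁', Y₂'⟩, Z'⟩ hYZ' h
    simp only [coe_product, Set.mem_prod, mem_coe, mem_powersetCard] at hYZ hYZ'
    simp only at h
    have hY₁ : Y₁ = Y₁' := by
      rw [← e1 Y₁ Y₂ Z hYZ.1.1.1 hYZ.1.2.1 hYZ.2.1, ← e1 Y₁' Y₂' Z' hYZ'.1.1.1 hYZ'.1.2.1 hYZ'.2.1, h]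
    have hY₂ : Y₂ = Y₂' := by
      rw [← e2 Y₁ Y₂ Z hYZ.1.1.1 hYZ.1.2.1 hYZ.2.1, ← e2 Y₁' Y₂' Z' hYZ'.1.1.1 hYZ'.1.2.1 hYZ'.2.1, h]
    have hZ : Z = Z' := by
      rw [← e3 Y₁ Y₂ Z hYZ.1.1.1 hYZ.1.2.1 hYZ.2.1, ← e3 Y₁' Y₂' Z' hYZ'.1.1.1 hYZ'.1.2.1 hYZ'.2.1, h]
    rw [hY₁, hY₂, hZ]

/-- **EVERY ROW `(q, u)`, `q < u < r`, ON TWO FAT FLATS PLUS FREE POINTS, SPLIT FORM, FROM THE ARITHMETIC CORE**: `M` finite,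
`gr M = E₁ ⊔ E₂ ⊔ E₃`, rank `min(r, min(|X∩E₁|, s₁) + min(|X∩E₂|, s₂) + |X∩E₃|)`; the hypothesis `hTF` is the two-flat
arithmetic core (TF) at `(k₁, s₁, k₂, s₂, m, q, u)`. -/
theorem profileIneq_rows_twoFlat_of_arith (hE : gr M = E₁ ∪ E₂ ∪ E₃) (h12 : Disjoint E₁ E₂)
    (h13 : Disjoint E₁ E₃) (h23 : Disjoint E₂ E₃)
    (hrk : ∀ X : Finset α, X ⊆ gr M →
      M.eRk (X : Set α) =
        ((min r (min (X ∩ E₁).card s₁ + min (X ∩ E₂).card s₂ + (X ∩ E₃).card) : ℕ) : ℕ∞))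
    {q u : ℕ} (hqu : q < u) (hur : u < r)
    (hTF : ∑ i₁ ∈ range (E₁.card + 1), ∑ i₂ ∈ range (E₂.card + 1),
        E₁.card.choose i₁ * E₂.card.choose i₂ *
          (if min i₁ s₁ + min i₂ s₂ ≤ q ∧
              u ≤ min (E₁.card - i₁) s₁ + min (E₂.card - i₂) s₂ + (E₃.card - (q - min i₁ s₁ - min i₂ s₂)) then
            E₃.card.choose (q - min i₁ s₁ - min i₂ s₂) *
              (min (E₁.card - i₁) s₁ + min (E₂.card - i₂) s₂ +
                (E₃.card - (q - min i₁ s₁ - min i₂ s₂))).choose (u - q)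
          else 0) ≤
      u.choose q * ∑ j₁ ∈ range (E₁.card + 1), ∑ j₂ ∈ range (E₂.card + 1),
        E₁.card.choose j₁ * E₂.card.choose j₂ *
          (if min j₁ s₁ + min j₂ s₂ ≤ u then E₃.card.choose (u - min j₁ s₁ - min j₂ s₂) else 0)) :
    Profile.ProfileIneq M q u := by
  unfold Profile.ProfileIneq
  set k₁ := E₁.card with hk₁
  set k₂ := E₂.card with hk₂
  set m := E₃.card with hm
  have hqr : q < r := by omega
  have hCpos : (0 : ℚ) < (u.choose q : ℚ) := by exact_mod_cast Nat.choose_pos hqu.le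
  -- the type price of the fibre `(i₁, i₂)`
  let p : ℕ → ℕ → ℕ := fun i₁ i₂ => min (k₁ - i₁) s₁ + min (k₂ - i₂) s₂ + (m - (q - min i₁ s₁ - min i₂ s₂))
  -- (a) the members, fibred by the numbers of fat points
  have hmaps : ∀ B ∈ Profile.Rq M q, ((B ∩ E₁).card, (B ∩ E₂).card) ∈ range (k₁ + 1) ×ˢ range (k₂ + 1) := by
    intro B _
    rw [mem_product, mem_range, mem_range, Nat.lt_succ_iff, Nat.lt_succ_iff]
    exact ⟨card_le_card inter_subset_right, card_le_card inter_subset_right⟩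
  have hA : ∑ B ∈ Profile.Rq M q, Profile.price M q u B ≤
      (∑ i₁ ∈ range (k₁ + 1), ∑ i₂ ∈ range (k₂ + 1), (k₁.choose i₁ : ℚ) * (k₂.choose i₂ : ℚ) *
        (if min i₁ s₁ + min i₂ s₂ ≤ q ∧ u ≤ p i₁ i₂ then
          ((m.choose (q - min i₁ s₁ - min i₂ s₂) : ℚ) * ((p i₁ i₂).choose (u - q) : ℚ)) else 0)) /
        (u.choose q : ℚ) := by
    rw [← sum_fiberwise_of_maps_to hmaps, sum_product, sum_div]
    apply sum_le_sum
    intro i₁ _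
    rw [sum_div]
    apply sum_le_sum
    intro i₂ _
    -- every member of the fibre has price at most the type price
    have hw : ∀ B ∈ (Profile.Rq M q).filter (fun B => ((B ∩ E₁).card, (B ∩ E₂).card) = (i₁, i₂)),
        Profile.price M q u B ≤
          (if u ≤ p i₁ i₂ then ((p i₁ i₂).choose (u - q) : ℚ) / (u.choose q : ℚ) else 0) := by
      intro B hB
      rw [mem_filter] at hB
      have := price_le_type_two M E₁ E₂ E₃ s₁ s₂ r hE hrk hqu.le hqr hB.1
      simp only [Prod.mk.injEq] at hB
      rw [hB.2.1, hB.2.2] at this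
      exact this
    calc ∑ B ∈ (Profile.Rq M q).filter (fun B => ((B ∩ E₁).card, (B ∩ E₂).card) = (i₁, i₂)),
            Profile.price M q u B
        ≤ ∑ B ∈ (Profile.Rq M q).filter (fun B => ((B ∩ E₁).card, (B ∩ E₂).card) = (i₁, i₂)),
            (if u ≤ p i₁ i₂ then ((p i₁ i₂).choose (u - q) : ℚ) / (u.choose q : ℚ) else 0) :=
          sum_le_sum hw
      _ = (((Profile.Rq M q).filter (fun B => ((B ∩ E₁).card, (B ∩ E₂).card) = (i₁, i₂))).card : ℚ) *
            (if u ≤ p i₁ i₂ then ((p i₁ i₂).choose (u - q) : ℚ) / (u.choose q : ℚ) else 0) := by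
          rw [sum_const, nsmul_eq_mul]
      _ ≤ ((k₁.choose i₁ : ℚ) * (k₂.choose i₂ : ℚ) *
            (if min i₁ s₁ + min i₂ s₂ ≤ q then (m.choose (q - min i₁ s₁ - min i₂ s₂) : ℚ) else 0)) *
            (if u ≤ p i₁ i₂ then ((p i₁ i₂).choose (u - q) : ℚ) / (u.choose q : ℚ) else 0) := by
          apply mul_le_mul_of_nonneg_right (card_Rq_two_le M E₁ E₂ E₃ s₁ s₂ r hE hrk q hqr i₁ i₂)
          split_ifs <;> positivity
      _ = (k₁.choose i₁ : ℚ) * (k₂.choose i₂ : ℚ) *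
            (if min i₁ s₁ + min i₂ s₂ ≤ q ∧ u ≤ p i₁ i₂ then
              ((m.choose (q - min i₁ s₁ - min i₂ s₂) : ℚ) * ((p i₁ i₂).choose (u - q) : ℚ)) else 0) /
            (u.choose q : ℚ) := by
          by_cases h1 : min i₁ s₁ + min i₂ s₂ ≤ q
          · by_cases h2 : u ≤ p i₁ i₂
            · rw [if_pos h1, if_pos h2, if_pos ⟨h1, h2⟩]; ring
            · simp [h1, h2]
          · simp [h1]
  -- (b) the level `u`, fibred by the numbers of fat points
  have hmaps' : ∀ S ∈ Shadow.levelSet M u,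
      ((S ∩ E₁).card, (S ∩ E₂).card) ∈ range (k₁ + 1) ×ˢ range (k₂ + 1) := by
    intro S _
    rw [mem_product, mem_range, mem_range, Nat.lt_succ_iff, Nat.lt_succ_iff]
    exact ⟨card_le_card inter_subset_right, card_le_card inter_subset_right⟩
  have hC : (∑ j₁ ∈ range (k₁ + 1), ∑ j₂ ∈ range (k₂ + 1), (k₁.choose j₁ : ℚ) * (k₂.choose j₂ : ℚ) *
      (if min j₁ s₁ + min j₂ s₂ ≤ u then (m.choose (u - min j₁ s₁ - min j₂ s₂) : ℚ) else 0)) ≤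
      ((Shadow.levelSet M u).card : ℚ) := by
    rw [card_eq_sum_card_fiberwise (fun S hS => mem_coe.2 (hmaps' S (mem_coe.1 hS))), sum_product]
    push_cast
    apply sum_le_sum
    intro j₁ _
    apply sum_le_sum
    intro j₂ _
    split_ifs with hju
    · exact_mod_cast card_levelSet_two_ge M E₁ E₂ E₃ s₁ s₂ r hE h12 h13 h23 hrk hur j₁ j₂ hju
    · rw [mul_zero]; positivity
  -- (c) the arithmetic core
  have hT' : ((∑ i₁ ∈ range (k₁ + 1), ∑ i₂ ∈ range (k₂ + 1), k₁.choose i₁ * k₂.choose i₂ *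
      (if min i₁ s₁ + min i₂ s₂ ≤ q ∧ u ≤ p i₁ i₂ then
        m.choose (q - min i₁ s₁ - min i₂ s₂) * (p i₁ i₂).choose (u - q) else 0) : ℕ) : ℚ) ≤
      ((u.choose q * ∑ j₁ ∈ range (k₁ + 1), ∑ j₂ ∈ range (k₂ + 1), k₁.choose j₁ * k₂.choose j₂ *
        (if min j₁ s₁ + min j₂ s₂ ≤ u then m.choose (u - min j₁ s₁ - min j₂ s₂) else 0) : ℕ) : ℚ) := by
    exact_mod_cast hTF
  push_cast at hT'
  have hT'' : (∑ i₁ ∈ range (k₁ + 1), ∑ i₂ ∈ range (k₂ + 1), (k₁.choose i₁ : ℚ) * (k₂.choose i₂ : ℚ) *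
        (if min i₁ s₁ + min i₂ s₂ ≤ q ∧ u ≤ p i₁ i₂ then
          ((m.choose (q - min i₁ s₁ - min i₂ s₂) : ℚ) * ((p i₁ i₂).choose (u - q) : ℚ)) else 0)) /
        (u.choose q : ℚ) ≤
      ∑ j₁ ∈ range (k₁ + 1), ∑ j₂ ∈ range (k₂ + 1), (k₁.choose j₁ : ℚ) * (k₂.choose j₂ : ℚ) *
        (if min j₁ s₁ + min j₂ s₂ ≤ u then (m.choose (u - min j₁ s₁ - min j₂ s₂) : ℚ) else 0) := by
    rw [div_le_iff₀ hCpos, mul_comm]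
    convert hT' using 2
  linarith [hA, hC, hT'']

end Split

end TwoFlat

end PercRepro
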